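import Literature.Algebra.Polynomial.BernoulliEulerAppell
import Literature.Algebra.Polynomial.BasicSequenceGeneratingFunctions
import Mathlib.Tactic
import HarnessLib

/-!
# Gregory's formula: the Bernoulli operator `J` expanded in powers of `Δ` (Rota–Kahaner–Odlyzko §13)

G.-C. Rota, D. Kahaner, A. Odlyzko, *Finite operator calculus* (1973), §13 "Difference Polynomials",
p. 742:

> They are the Sheffer sets associated with the difference operator `Δ = E − I`, having the basic
> polynomials `(x)_n = x (x − 1) ⋯ (x − n + 1)`. … The first expansion theorem applied to `Δ` gives the
> Newton expansion. The expansion of the Bernoulli operator `J` in powers of `Δ` is Gregory's formula.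

(`J p (x) = ∫_x^{x+1} p (t) dt`, `J = (e^D − 1)/D`, §13 p. 737.) Since `Δ = e^D − 1` and `D = log (I + Δ)`,
`J = Δ/log (I + Δ) = λ(Δ)⁻¹` with `λ(t) = log (1 + t)/t` (the tree's `logDivX K`, `BellTouchardPolynomials`);
the coefficients `G_k = [tᵏ] t/log (1 + t)` (`1, 1/2, −1/12, 1/24, …`) are the Gregory coefficients and
Gregory's formula reads `∫_x^{x+1} f = Σ_k G_k Δᵏ f (x)`.

Typed here (all proved): `λ (e^t − 1) = t/(e^t − 1)` (`logDivX_subst_exp_sub_one`), the `Δ`-indicator of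
`J` is `t/log (1 + t) = λ⁻¹` (`indicator_forwardDifference_J`), **Gregory's formula** as the First
Expansion Theorem for `J` relative to `Δ` (`gregory_formula`: `J f = Σ_{k<N} G_k Δᵏ f`; evaluated with
`F′ = f`: `F (y+1) − F (y) = Σ_k G_k (Δᵏ f)(y)`, `gregory_formula_eval`), the first Gregory coefficients
`G_0 = 1`, `G_1 = 1/2`, `G_2 = −1/12` (`gregoryCoeff_zero/one/two`), and **Newton's expansion** for `Δ`
(`newton_expansion`: `f (x + y) = Σ_k (Δᵏ f)(y)/k! · (x)_k`, the tree's generalized Taylor expansion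
`IsBasicSequence.taylor_eq_sum` for `Δ`, `(x)_n = descPochhammer K n`).

## References
* [RotaKahanerOdlyzko1973] G.-C. Rota, D. Kahaner, A. Odlyzko, *On the foundations of
  combinatorial theory VIII. Finite operator calculus*, J. Math. Anal. Appl. 42 (1973) 684–760,
  §13, pp. 737, 742 (with §3 Theorem 2, p. 691).
-/

noncomputable section

open Polynomial Finset

namespace Literature.Algebra.Polynomial

variable (K : Type*) [Field K] [CharZero K]

/-- `e^t − 1` has no constant term. [cite: RotaKahanerOdlyzko1973, §13, p. 742] -/
theorem constantCoeff_exp_sub_one : PowerSeries.constantCoeff (PowerSeries.exp K - 1) = 0 := by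
  rw [map_sub, PowerSeries.constantCoeff_exp, map_one, sub_self]

/-- **`λ (e^t − 1) = t/(e^t − 1)`**: substituting `Δ`'s symbol into `λ(t) = log (1 + t)/t` gives the
symbol of `J⁻¹ = D/(e^D − 1)` (from `log (1 + (e^t − 1)) = t`).
[cite: RotaKahanerOdlyzko1973, §13 ("`J` in powers of `Δ`"), p. 742] -/
theorem logDivX_subst_exp_sub_one :
    ((logDivX K).subst (PowerSeries.exp K - 1) : PowerSeries K) = bernoulliPowerSeries K := by
  have hs := PowerSeries.HasSubst.of_constantCoeff_zero' (constantCoeff_exp_sub_one K)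
  -- `t λ(t) = log (1 + t)` at `t ↦ e^t − 1`: `(e^t − 1) · λ (e^t − 1) = t`
  have h := congrArg (PowerSeries.subst (PowerSeries.exp K - 1)) (X_mul_logDivX K)
  rw [PowerSeries.subst_mul hs, PowerSeries.subst_X hs, log_subst_exp_sub_one] at h
  -- cancel `t`, then multiply by `t/(e^t − 1)`
  have h1 : (bernoulliPowerSeries K)⁻¹ * (logDivX K).subst (PowerSeries.exp K - 1) = 1 :=
    PowerSeries.X_mul_cancel (by rw [mul_one, ← mul_assoc, X_mul_bernoulliPowerSeries_inv]; exact h)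
  have h2 : bernoulliPowerSeries K * ((bernoulliPowerSeries K)⁻¹ * (logDivX K).subst (PowerSeries.exp K - 1)) =
      bernoulliPowerSeries K * 1 := by rw [h1]
  rwa [← mul_assoc, PowerSeries.mul_inv_cancel _ (constantCoeff_bernoulliPowerSeries_ne_zero K), one_mul,
    mul_one] at h2

/-- **`J = Δ/log (I + Δ)`**: the `Δ`-indicator of `J = (e^D − 1)/D` is `t/log (1 + t) = λ(t)⁻¹`.
[cite: RotaKahanerOdlyzko1973, §13 ("The expansion of the Bernoulli operator `J` in powers of `Δ` is
Gregory's formula"), p. 742] -/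
theorem indicator_forwardDifference_J :
    (isDeltaOperator_taylor_sub_id (K := K)).indicator (diffOp (bernoulliPowerSeries K)⁻¹) = (logDivX K)⁻¹ := by
  have h := (isDeltaOperator_taylor_sub_id (K := K)).indicator_diffOp_subst forwardDifference_eq_diffOp
    (logDivX K)⁻¹
  rwa [powerSeries_inv_subst (constantCoeff_exp_sub_one K) (constantCoeff_logDivX_ne_zero K),
    logDivX_subst_exp_sub_one] at h

/-- **Gregory's formula**: `J f = Σ_{k<N} G_k Δᵏ f` with `G_k = [tᵏ] t/log (1 + t)` (`N > deg f`) — the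
First Expansion Theorem for `J` relative to `Δ`. [cite: RotaKahanerOdlyzko1973, §13, p. 742]
[cite: RotaKahanerOdlyzko1973, §3 Theorem 2, p. 691] -/
theorem gregory_formula (f : K[X]) {N : ℕ} (hN : f.natDegree < N) :
    diffOp (bernoulliPowerSeries K)⁻¹ f =
      ∑ k ∈ range N, PowerSeries.coeff k (logDivX K)⁻¹ •
        ((taylor (1 : K) - LinearMap.id : K[X] →ₗ[K] K[X]) ^ k) f := by
  rw [(isShiftInvariant_diffOp _).eq_sum_coeff_indicator_smul isDeltaOperator_taylor_sub_id f hN,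
    indicator_forwardDifference_J]

/-- **Gregory's formula, evaluated**: for `F′ = f`, `∫_y^{y+1} f = F (y + 1) − F (y) = Σ_{k<N} G_k (Δᵏ f)(y)`.
[cite: RotaKahanerOdlyzko1973, §13, pp. 737, 742] -/
theorem gregory_formula_eval {f F : K[X]} (hF : derivative F = f) (y : K) {N : ℕ} (hN : f.natDegree < N) :
    F.eval (y + 1) - F.eval y = ∑ k ∈ range N, PowerSeries.coeff k (logDivX K)⁻¹ *
      (((taylor (1 : K) - LinearMap.id : K[X] →ₗ[K] K[X]) ^ k) f).eval y := by
  have hJ : diffOp (bernoulliPowerSeries K)⁻¹ f = taylor (1 : K) F - F := by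
    rw [← hF, ← derivative_diffOp, ← LinearMap.comp_apply, derivative_comp_diffOp_bernoulliPowerSeries_inv,
      LinearMap.sub_apply, LinearMap.id_apply]
  have h := congrArg (eval y) (gregory_formula K f hN)
  rw [hJ, eval_sub, taylor_eval, eval_finsetSum] at h
  rw [h]
  exact sum_congr rfl fun k _ => by rw [eval_smul, smul_eq_mul]

/-! ## The first Gregory coefficients `G_0 = 1`, `G_1 = 1/2`, `G_2 = −1/12` -/

omit [CharZero K] in
/-- `λ⁻¹ · λ = 1`. [cite: RotaKahanerOdlyzko1973, §13, p. 742] -/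
theorem logDivX_inv_mul : (logDivX K)⁻¹ * logDivX K = 1 :=
  PowerSeries.inv_mul_cancel _ (constantCoeff_logDivX_ne_zero K)

omit [CharZero K] in
/-- `[tᵏ] λ = (−1)ᵏ/(k+1)`. [cite: RotaKahanerOdlyzko1973, §13, p. 742] -/
theorem coeff_logDivX (k : ℕ) : PowerSeries.coeff k (logDivX K) = (-1 : K) ^ k / ((k : K) + 1) := by
  rw [logDivX, PowerSeries.coeff_mk]

omit [CharZero K] in
/-- **`G_0 = 1`.** [cite: RotaKahanerOdlyzko1973, §13, p. 742] -/
theorem gregoryCoeff_zero : PowerSeries.coeff 0 (logDivX K)⁻¹ = 1 := by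
  rw [PowerSeries.coeff_zero_eq_constantCoeff_apply, PowerSeries.constantCoeff_inv, constantCoeff_logDivX, inv_one]

/-- **`G_1 = 1/2`.** [cite: RotaKahanerOdlyzko1973, §13, p. 742] -/
theorem gregoryCoeff_one : PowerSeries.coeff 1 (logDivX K)⁻¹ = 1 / 2 := by
  have h := congrArg (PowerSeries.coeff 1) (logDivX_inv_mul K)
  rw [PowerSeries.coeff_mul, Finset.Nat.antidiagonal_succ, Finset.sum_cons, Finset.Nat.antidiagonal_zero,
    Finset.map_singleton, Finset.sum_singleton, PowerSeries.coeff_one, if_neg one_ne_zero] at h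
  simp only [Function.Embedding.coe_prodMap, Function.Embedding.coeFn_mk, Prod.map_apply, Nat.succ_eq_add_one,
    Function.Embedding.refl_apply, zero_add, gregoryCoeff_zero, coeff_logDivX, pow_zero, pow_one, Nat.cast_zero,
    Nat.cast_one] at h
  have h' : PowerSeries.coeff 1 (logDivX K)⁻¹ = 1 / (1 + 1) := by linear_combination h
  rw [h']
  norm_num

/-- **`G_2 = −1/12`.** [cite: RotaKahanerOdlyzko1973, §13, p. 742] -/
theorem gregoryCoeff_two : PowerSeries.coeff 2 (logDivX K)⁻¹ = -1 / 12 := by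
  have h := congrArg (PowerSeries.coeff 2) (logDivX_inv_mul K)
  rw [PowerSeries.coeff_mul, show (2 : ℕ) = 1 + 1 from rfl, Finset.Nat.antidiagonal_succ, Finset.sum_cons,
    Finset.Nat.antidiagonal_succ, Finset.map_cons, Finset.sum_cons, Finset.Nat.antidiagonal_zero,
    Finset.map_singleton, Finset.map_singleton, Finset.sum_singleton, PowerSeries.coeff_one,
    if_neg (by norm_num : 1 + 1 ≠ 0)] at h
  simp only [Function.Embedding.coe_prodMap, Function.Embedding.coeFn_mk, Prod.map_apply, Nat.succ_eq_add_one,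
    Function.Embedding.refl_apply, zero_add, gregoryCoeff_zero, gregoryCoeff_one, coeff_logDivX, pow_zero, pow_one,
    Nat.cast_zero, Nat.cast_one] at h
  norm_num at h
  have h' : PowerSeries.coeff 2 (logDivX K)⁻¹ = -(1 / 3) + 1 / 4 := by linear_combination h
  rw [h']
  norm_num

/-! ## Newton's expansion -/

/-- **"The first expansion theorem applied to `Δ` gives the Newton expansion"**:
`f (x + y) = Σ_{k<N} (Δᵏ f)(y)/k! · (x)_k`, i.e. `E^y f = Σ_k (Δᵏ f)(y)/k! (x)_k` (`N > deg f`).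
[cite: RotaKahanerOdlyzko1973, §13, p. 742] [cite: RotaKahanerOdlyzko1973, §3 Theorem 2, p. 691] -/
theorem newton_expansion (f : K[X]) (y : K) {N : ℕ} (hN : f.natDegree < N) :
    taylor y f = ∑ k ∈ range N,
      ((((taylor (1 : K) - LinearMap.id : K[X] →ₗ[K] K[X]) ^ k) f).eval y / (k.factorial : K)) •
        descPochhammer K k :=
  isBasicSequence_descPochhammer.taylor_eq_sum isDeltaOperator_taylor_sub_id f y hN

end Literature.Algebra.Polynomial
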